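import Summits.QuantumFields.YangMills.Theorems.LuscherReductionDressedRitzPlateauSpreadFree
import HarnessLib

/-!
# Route `LuscherReduction`, item `DressedRitz` (stmt-QuantumFields-20205) — reduction chain, file 9: the ORDER clause (x1) is REDUNDANT too —
# `ExcitedPlateauAt k` from the five clauses (x2)–(x6), by sorting the excited generators (decreasing rearrangement respects Lüscher position)

Support module of the `FemtoTransferGap` group (fleet service by seat ym-infvol-p2 g6; route `LuscherReduction`, femto rung R2b1; bears on the
crux child `DressedRitz` = stmt-QuantumFields-20205 of RED stmt-QuantumFields-19978).  NEW (not in the planner's workfiles).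

WHY IT IS FREE.  Clause (x1) of `KTGen.ExcitedPlateauAt k` asks the excited diagonal values `d_i = ⟨w_i, K_β w_i⟩` to be SORTED (`d_0 ≥ d_1 ≥ …`)
while (x5) pins each `d_i` to the one-site level `μ_{i+1}` two-sidedly, `e^{−Cλ²/L} ≤ (d_i μ₀)/(μ_{i+1} λ₀) ≤ e^{Cλ²/L}`.  The other clauses
(x2), (x3), (x4), (x6) are invariant under relabelling the generators.  RELABEL by a permutation `σ` that sorts `d` decreasingly: the classical
monotonicity of the decreasing rearrangement — if `a ≤ b` pointwise and `b` is antitone then `a↓ ≤ b` pointwise (`sorted_le_of_le`), and if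
`b ≤ a` pointwise then `b ≤ a↓` (`le_sorted_of_le`) — applied with the ANTITONE comparison sequence `j ↦ μ_{j+1}` (`levelValue_antitone` at `L = 1`)
shows that (x5) survives the relabelling with the SAME constant.  Together with file 7 (`excitedPlateauAt_of_core`, the spread clause (x7) from
the closed crux ONE) the prover's list for item 20205 through the excited-sector cut is (x2)–(x6): near-orthogonality, vacuum overlap, one-step
residuals, two-sided Lüscher position, symmetrised couplings — no ordering, no spread.

* §1 `sorted_le_of_le`, `le_sorted_of_le` — decreasing rearrangement vs an antitone sequence (pure order theory on `Fin n → ℝ`, by counting).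
* §2 ★ `excitedCore_of_unsorted` — (x2)–(x6) ⇒ (x1)–(x6) (same constants), and ★★ `excitedPlateauAt_of_unsorted : (x2)–(x6) data → ExcitedPlateauAt k`,
  `dressedRitzAt_of_unsorted : … → DressedRitzAt k`.
* §3 ★ `operatorCore_of_unsorted` (sort the insertions by effective mass `d_ii/n_i`), ★★ `operatorPlateauAt_of_unsorted : (o0),(o2)–(o6) data →
  OperatorPlateauAt k` — the prover's list in operator language is (o0), (o2), (o4), (o5), (o6).

HONEST FRAMING: order-theoretic bookkeeping on the femto rung R2b1; proves nothing OF `DressedRitz`; no bearing on infinite volume, the continuum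
limit or the Clay mass gap.  References: M. Lüscher, NPB 219 (1983) 233 [cite: Luscher1983, §3]; rearrangement monotonicity is folklore.
-/

set_option autoImplicit false

noncomputable section

open MeasureTheory Filter Topology Real
open Literature.MathematicalPhysics.QuantumFieldTheory
open Literature.MathematicalPhysics.QuantumLattice
open Literature.Analysis.OperatorTheory.YMMatrixModel
open scoped BigOperators

namespace Summit.QuantumFields.YangMills.Theorems.FemtoTransferGap.KTGen

open Summit.QuantumFields.YangMills.Theorems.FemtoTransferGap
open Summit.QuantumFields.YangMills.Theorems.FemtoTransferGap.KTRCalibration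
open Summit.QuantumFields.YangMills.Theorems.FemtoTransferGap.PhysL2

/-! ## §1 Decreasing rearrangement vs an antitone sequence -/

section Rearrangement

variable {n : ℕ} {a b : Fin n → ℝ} (σ : Equiv.Perm (Fin n))

/-- **`a ≤ b`, `b` antitone, `a ∘ σ` antitone ⇒ `a (σ j) ≤ b j`**: the `j+1` indices `σ 0, …, σ j` all have `b ≥ a(σ j)`, and an antitone `b` exceeds
a value at `> j` indices only if it does so at index `j`. [folklore] -/
theorem sorted_le_of_le (hσ : Antitone (a ∘ σ)) (hb : Antitone b) (hab : ∀ i, a i ≤ b i) (j : Fin n) :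
    a (σ j) ≤ b j := by
  classical
  by_contra hlt
  push Not at hlt
  -- every index `i` with `a (σ j) ≤ b i` is `< j`
  have hsub : (Finset.univ.filter fun i : Fin n => a (σ j) ≤ b i) ⊆ Finset.univ.filter fun i : Fin n => i < j := by
    intro i hi
    simp only [Finset.mem_filter, Finset.mem_univ, true_and] at hi ⊢
    by_contra hji
    push Not at hji
    exact absurd (hi.trans (hb hji)) (not_le.mpr hlt)
  -- but `σ m`, `m ≤ j`, are `j+1` such indices
  have hsup : (Finset.Iic j).image σ ⊆ Finset.univ.filter fun i : Fin n => a (σ j) ≤ b i := by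
    intro i hi
    simp only [Finset.mem_image, Finset.mem_Iic] at hi
    obtain ⟨m, hm, rfl⟩ := hi
    simp only [Finset.mem_filter, Finset.mem_univ, true_and]
    exact (hσ hm).trans (hab (σ m))
  have h1 : ((Finset.Iic j).image σ).card = (j : ℕ) + 1 := by
    rw [Finset.card_image_of_injective _ σ.injective, Fin.card_Iic]
  have h2 : (Finset.univ.filter fun i : Fin n => i < j).card = (j : ℕ) := by
    have : (Finset.univ.filter fun i : Fin n => i < j) = Finset.Iio j := by
      ext i; simp [Finset.mem_Iio]
    rw [this, Fin.card_Iio]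
  have := (Finset.card_le_card hsup).trans (Finset.card_le_card hsub)
  rw [h1, h2] at this
  omega

/-- **`b ≤ a`, `b` antitone, `a ∘ σ` antitone ⇒ `b j ≤ a (σ j)`**: otherwise the `j+1` indices `0, …, j` have `a ≥ b > a(σ j)`, but `a ∘ σ` exceeds
`a(σ j)` at `< j` only at indices below `j`. [folklore] -/
theorem le_sorted_of_le (hσ : Antitone (a ∘ σ)) (hb : Antitone b) (hba : ∀ i, b i ≤ a i) (j : Fin n) :
    b j ≤ a (σ j) := by
  classical
  by_contra hlt
  push Not at hlt
  -- indices `m` with `a (σ j) < a (σ m)` are `< j`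
  have hsub : (Finset.univ.filter fun m : Fin n => a (σ j) < a (σ m)) ⊆ Finset.univ.filter fun m : Fin n => m < j := by
    intro m hm
    simp only [Finset.mem_filter, Finset.mem_univ, true_and] at hm ⊢
    by_contra hjm
    push Not at hjm
    exact absurd (hσ hjm) (not_le.mpr hm)
  -- the indices `σ⁻¹ i`, `i ≤ j`, are `j+1` such indices
  have hsup : (Finset.Iic j).image σ.symm ⊆ Finset.univ.filter fun m : Fin n => a (σ j) < a (σ m) := by
    intro m hm
    simp only [Finset.mem_image, Finset.mem_Iic] at hm
    obtain ⟨i, hi, rfl⟩ := hm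
    simp only [Finset.mem_filter, Finset.mem_univ, true_and, Equiv.apply_symm_apply]
    exact hlt.trans_le ((hb hi).trans (hba i))
  have h1 : ((Finset.Iic j).image σ.symm).card = (j : ℕ) + 1 := by
    rw [Finset.card_image_of_injective _ σ.symm.injective, Fin.card_Iic]
  have h2 : (Finset.univ.filter fun m : Fin n => m < j).card = (j : ℕ) := by
    have : (Finset.univ.filter fun m : Fin n => m < j) = Finset.Iio j := by
      ext i; simp [Finset.mem_Iio]
    rw [this, Fin.card_Iio]
  have := (Finset.card_le_card hsup).trans (Finset.card_le_card hsub)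
  rw [h1, h2] at this
  omega

/-- A permutation sorting a real `n`-tuple DECREASINGLY (`Tuple.sort` composed with index reversal). [folklore] -/
theorem exists_perm_antitone (d : Fin n → ℝ) : ∃ σ : Equiv.Perm (Fin n), Antitone (d ∘ σ) := by
  refine ⟨Fin.revPerm.trans (Tuple.sort d), fun i l hil => ?_⟩
  have hmono := Tuple.monotone_sort d
  show d ((Tuple.sort d) (Fin.rev l)) ≤ d ((Tuple.sort d) (Fin.rev i))
  exact hmono (Fin.rev_le_rev.mpr hil)

end Rearrangement

/-! ## §2 `ExcitedPlateauAt k` from (x2)–(x6): sort, then add the spread (file 7) -/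

/-- ★ **(x2)–(x6) ⇒ the sorted core (x1)–(x6), same constants.**  Relabel the excited generators by a permutation sorting the diagonal values
decreasingly; (x5) survives by `sorted_le_of_le` ∕ `le_sorted_of_le` against the antitone one-site levels `j ↦ μ_{j+1}`. [cite: Luscher1983, §3] -/
theorem excitedCore_of_unsorted {k : ℕ} {C : ℝ} {L : ℕ} [NeZero L] {β : ℝ} (hβ : 0 ≤ β)
    {w : Fin k → (GaugeConfig 3 L SU2 → ℝ)}
    (hw : ∀ i, IsPhys (w i)) (hunit : ∀ i, l2 (w i) (w i) = 1)
    (horth : ∀ i l : Fin k, i ≠ l → |l2 (w i) (w l)| ≤ C * luscherLambda β L)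
    (hvac : ∃ φ : GaugeConfig 3 L SU2 → ℝ, IsPhys φ ∧ l2 φ φ = 1 ∧
        transferApply β φ = levelValue su2Rep L β 0 • φ ∧ ∀ i, |l2 φ (w i)| ≤ C * luscherLambda β L)
    (hres : ∀ i, l2 (transferApply β (w i) - qform su2Rep β (w i) (w i) • w i)
        (transferApply β (w i) - qform su2Rep β (w i) (w i) • w i)
        ≤ C * (luscherLambda β L ^ 3 / (L : ℝ) ^ 2) * levelValue su2Rep L β 0 ^ 2)
    (hlus : ∀ i : Fin k,
      qform su2Rep β (w i) (w i) * levelValue su2Rep 1 (oneSiteCoupling β L) 0 ≤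
          Real.exp (C * luscherLambda β L ^ 2 / L) *
            (levelValue su2Rep 1 (oneSiteCoupling β L) ((i : ℕ) + 1) * levelValue su2Rep L β 0) ∧
      levelValue su2Rep 1 (oneSiteCoupling β L) ((i : ℕ) + 1) * levelValue su2Rep L β 0 ≤
          Real.exp (C * luscherLambda β L ^ 2 / L) *
            (qform su2Rep β (w i) (w i) * levelValue su2Rep 1 (oneSiteCoupling β L) 0))
    (hcoup : ∀ i l : Fin k, i ≠ l →
      |qform su2Rep β (w i) (w l) - (qform su2Rep β (w i) (w i) + qform su2Rep β (w l) (w l)) / 2 * l2 (w i) (w l)|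
        ≤ C * (luscherLambda β L ^ 2 / L) * levelValue su2Rep L β 0) :
    ∃ w' : Fin k → (GaugeConfig 3 L SU2 → ℝ),
      (∀ i, IsPhys (w' i)) ∧ (∀ i, l2 (w' i) (w' i) = 1) ∧
      (∀ i l : Fin k, i ≤ l → qform su2Rep β (w' l) (w' l) ≤ qform su2Rep β (w' i) (w' i)) ∧
      (∀ i l : Fin k, i ≠ l → |l2 (w' i) (w' l)| ≤ C * luscherLambda β L) ∧
      (∃ φ : GaugeConfig 3 L SU2 → ℝ, IsPhys φ ∧ l2 φ φ = 1 ∧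
          transferApply β φ = levelValue su2Rep L β 0 • φ ∧ ∀ i, |l2 φ (w' i)| ≤ C * luscherLambda β L) ∧
      (∀ i, l2 (transferApply β (w' i) - qform su2Rep β (w' i) (w' i) • w' i)
          (transferApply β (w' i) - qform su2Rep β (w' i) (w' i) • w' i)
          ≤ C * (luscherLambda β L ^ 3 / (L : ℝ) ^ 2) * levelValue su2Rep L β 0 ^ 2) ∧
      (∀ i : Fin k,
        qform su2Rep β (w' i) (w' i) * levelValue su2Rep 1 (oneSiteCoupling β L) 0 ≤
            Real.exp (C * luscherLambda β L ^ 2 / L) *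
              (levelValue su2Rep 1 (oneSiteCoupling β L) ((i : ℕ) + 1) * levelValue su2Rep L β 0) ∧
        levelValue su2Rep 1 (oneSiteCoupling β L) ((i : ℕ) + 1) * levelValue su2Rep L β 0 ≤
            Real.exp (C * luscherLambda β L ^ 2 / L) *
              (qform su2Rep β (w' i) (w' i) * levelValue su2Rep 1 (oneSiteCoupling β L) 0)) ∧
      (∀ i l : Fin k, i ≠ l →
        |qform su2Rep β (w' i) (w' l) - (qform su2Rep β (w' i) (w' i) + qform su2Rep β (w' l) (w' l)) / 2 * l2 (w' i) (w' l)|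
          ≤ C * (luscherLambda β L ^ 2 / L) * levelValue su2Rep L β 0) := by
  set d : Fin k → ℝ := fun i => qform su2Rep β (w i) (w i) with hd
  obtain ⟨σ, hσ⟩ := exists_perm_antitone d
  have hB : 0 ≤ oneSiteCoupling β L := oneSiteCoupling_nonneg β L
  set μ0 : ℝ := levelValue su2Rep 1 (oneSiteCoupling β L) 0 with hμ0
  set l0 : ℝ := levelValue su2Rep L β 0 with hl0
  set E : ℝ := Real.exp (C * luscherLambda β L ^ 2 / L) with hE
  have hE0 : 0 ≤ E := (Real.exp_pos _).le
  have hμ00 : 0 ≤ μ0 := levelValue_su2Rep_nonneg 1 hB 0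
  have hl00 : 0 ≤ l0 := levelValue_su2Rep_nonneg L hβ 0
  set μ : Fin k → ℝ := fun j => levelValue su2Rep 1 (oneSiteCoupling β L) ((j : ℕ) + 1) with hμdef
  have hμanti : Antitone μ := fun i l hil =>
    levelValue_antitone (L := 1) hB (Nat.succ_le_succ (Fin.le_def.mp hil))
  -- (x5).1 : `a ≤ b` with `a i = d_i μ₀`, `b j = E μ_j λ₀` (antitone)
  have h51 : ∀ j, (fun i => d i * μ0) (σ j) ≤ (fun j => E * (μ j * l0)) j := by
    refine sorted_le_of_le σ (a := fun i => d i * μ0) (b := fun j => E * (μ j * l0)) ?_ ?_ (fun i => (hlus i).1)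
    · exact fun i l hil => mul_le_mul_of_nonneg_right (hσ hil) hμ00
    · exact fun i l hil => mul_le_mul_of_nonneg_left (mul_le_mul_of_nonneg_right (hμanti hil) hl00) hE0
  -- (x5).2 : `b' ≤ a'` with `b' j = μ_j λ₀` (antitone), `a' i = E d_i μ₀`
  have h52 : ∀ j, (fun j => μ j * l0) j ≤ (fun i => E * (d i * μ0)) (σ j) := by
    refine le_sorted_of_le σ (a := fun i => E * (d i * μ0)) (b := fun j => μ j * l0) ?_ ?_ (fun i => (hlus i).2)
    · exact fun i l hil => mul_le_mul_of_nonneg_left (mul_le_mul_of_nonneg_right (hσ hil) hμ00) hE0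
    · exact fun i l hil => mul_le_mul_of_nonneg_right (hμanti hil) hl00
  obtain ⟨φ, hφ, hφ1, hKφ, hvacw⟩ := hvac
  refine ⟨fun j => w (σ j), fun j => hw _, fun j => hunit _, fun i l hil => hσ hil,
    fun i l hil => horth _ _ (fun h => hil (σ.injective h)), ⟨φ, hφ, hφ1, hKφ, fun j => hvacw _⟩, fun j => hres _,
    fun j => ⟨h51 j, h52 j⟩, fun i l hil => hcoup _ _ (fun h => hil (σ.injective h))⟩

/-- ★★ **`ExcitedPlateauAt k` from (x2)–(x6) only** (no ordering, no spread): sort (`excitedCore_of_unsorted`), then file 7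
(`excitedPlateauAt_of_core`, crux ONE closed). [cite: Luscher1983, §3] -/
theorem excitedPlateauAt_of_unsorted {k : ℕ}
    (h : ∃ C lam0 : ℝ, 0 < lam0 ∧ ∀ lam : ℝ, 0 < lam → lam ≤ lam0 → ∃ L0 : ℕ,
      ∀ (L : ℕ) [NeZero L], L0 ≤ L → ∀ β : ℝ, InFemtoWindow lam β L →
        ∃ w : Fin k → (GaugeConfig 3 L SU2 → ℝ),
          (∀ i, IsPhys (w i)) ∧ (∀ i, l2 (w i) (w i) = 1) ∧
          (∀ i l : Fin k, i ≠ l → |l2 (w i) (w l)| ≤ C * luscherLambda β L) ∧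
          (∃ φ : GaugeConfig 3 L SU2 → ℝ, IsPhys φ ∧ l2 φ φ = 1 ∧
              transferApply β φ = levelValue su2Rep L β 0 • φ ∧ ∀ i, |l2 φ (w i)| ≤ C * luscherLambda β L) ∧
          (∀ i, l2 (transferApply β (w i) - qform su2Rep β (w i) (w i) • w i)
              (transferApply β (w i) - qform su2Rep β (w i) (w i) • w i)
              ≤ C * (luscherLambda β L ^ 3 / (L : ℝ) ^ 2) * levelValue su2Rep L β 0 ^ 2) ∧
          (∀ i : Fin k,
            qform su2Rep β (w i) (w i) * levelValue su2Rep 1 (oneSiteCoupling β L) 0 ≤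
                Real.exp (C * luscherLambda β L ^ 2 / L) *
                  (levelValue su2Rep 1 (oneSiteCoupling β L) ((i : ℕ) + 1) * levelValue su2Rep L β 0) ∧
            levelValue su2Rep 1 (oneSiteCoupling β L) ((i : ℕ) + 1) * levelValue su2Rep L β 0 ≤
                Real.exp (C * luscherLambda β L ^ 2 / L) *
                  (qform su2Rep β (w i) (w i) * levelValue su2Rep 1 (oneSiteCoupling β L) 0)) ∧
          (∀ i l : Fin k, i ≠ l →
            |qform su2Rep β (w i) (w l) - (qform su2Rep β (w i) (w i) + qform su2Rep β (w l) (w l)) / 2 * l2 (w i) (w l)|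
              ≤ C * (luscherLambda β L ^ 2 / L) * levelValue su2Rep L β 0)) :
    ExcitedPlateauAt k := by
  obtain ⟨C, lam0, hlam0, hC⟩ := h
  refine excitedPlateauAt_of_core ⟨C, lam0, hlam0, fun lam hlam hle => ?_⟩
  obtain ⟨L0, hL⟩ := hC lam hlam hle
  refine ⟨L0, fun L _ hL0 β hW => ?_⟩
  obtain ⟨w, hw, hunit, horth, hvac, hres, hlus, hcoup⟩ := hL L hL0 β hW
  have hβ : (0 : ℝ) ≤ β := zero_le_one.trans hW.1
  exact excitedCore_of_unsorted hβ hw hunit horth hvac hres hlus hcoup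

/-- `DressedRitzAt k` from (x2)–(x6) only. [cite: Luscher1983, §3] -/
theorem dressedRitzAt_of_unsorted {k : ℕ}
    (h : ∃ C lam0 : ℝ, 0 < lam0 ∧ ∀ lam : ℝ, 0 < lam → lam ≤ lam0 → ∃ L0 : ℕ,
      ∀ (L : ℕ) [NeZero L], L0 ≤ L → ∀ β : ℝ, InFemtoWindow lam β L →
        ∃ w : Fin k → (GaugeConfig 3 L SU2 → ℝ),
          (∀ i, IsPhys (w i)) ∧ (∀ i, l2 (w i) (w i) = 1) ∧
          (∀ i l : Fin k, i ≠ l → |l2 (w i) (w l)| ≤ C * luscherLambda β L) ∧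
          (∃ φ : GaugeConfig 3 L SU2 → ℝ, IsPhys φ ∧ l2 φ φ = 1 ∧
              transferApply β φ = levelValue su2Rep L β 0 • φ ∧ ∀ i, |l2 φ (w i)| ≤ C * luscherLambda β L) ∧
          (∀ i, l2 (transferApply β (w i) - qform su2Rep β (w i) (w i) • w i)
              (transferApply β (w i) - qform su2Rep β (w i) (w i) • w i)
              ≤ C * (luscherLambda β L ^ 3 / (L : ℝ) ^ 2) * levelValue su2Rep L β 0 ^ 2) ∧
          (∀ i : Fin k,
            qform su2Rep β (w i) (w i) * levelValue su2Rep 1 (oneSiteCoupling β L) 0 ≤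
                Real.exp (C * luscherLambda β L ^ 2 / L) *
                  (levelValue su2Rep 1 (oneSiteCoupling β L) ((i : ℕ) + 1) * levelValue su2Rep L β 0) ∧
            levelValue su2Rep 1 (oneSiteCoupling β L) ((i : ℕ) + 1) * levelValue su2Rep L β 0 ≤
                Real.exp (C * luscherLambda β L ^ 2 / L) *
                  (qform su2Rep β (w i) (w i) * levelValue su2Rep 1 (oneSiteCoupling β L) 0)) ∧
          (∀ i l : Fin k, i ≠ l →
            |qform su2Rep β (w i) (w l) - (qform su2Rep β (w i) (w i) + qform su2Rep β (w l) (w l)) / 2 * l2 (w i) (w l)|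
              ≤ C * (luscherLambda β L ^ 2 / L) * levelValue su2Rep L β 0)) :
    DressedRitzAt k :=
  dressedRitzAt_of_excitedPlateauAt (excitedPlateauAt_of_unsorted h)

/-! ## §3 `OperatorPlateauAt k` from (o0), (o2)–(o6): sort the insertions by effective mass -/

/-- ★ **(o0), (o2)–(o6) ⇒ the core (o0)–(o6) for the RELABELLED insertions `O ∘ σ`, same constant**, `σ` sorting the one-step effective
masses `d_ii/n_i` decreasingly; (o5) survives by `sorted_le_of_le` ∕ `le_sorted_of_le` (divide and re-multiply by `n_i > 0`).
[cite: LuscherWolff1990] -/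
theorem operatorCore_of_unsorted {k : ℕ} {C : ℝ} {L : ℕ} [NeZero L] {β : ℝ} (hβ : 0 ≤ β)
    {u : Fin k → (GaugeConfig 3 L SU2 → ℝ)}
    (h0 : ∀ i : Fin k, 0 < l2 (u i) (u i))
    (h2 : ∀ i l : Fin k, i ≠ l →
      |l2 (u i) (u l)| ≤ C * luscherLambda β L * (Real.sqrt (l2 (u i) (u i)) * Real.sqrt (l2 (u l) (u l))))
    (h4 : ∀ i : Fin k,
      l2 (transferApply β (u i)) (transferApply β (u i)) * l2 (u i) (u i) - l2 (u i) (transferApply β (u i)) ^ 2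
        ≤ C * (luscherLambda β L ^ 3 / (L : ℝ) ^ 2) * levelValue su2Rep L β 0 ^ 2 * l2 (u i) (u i) ^ 2)
    (h5 : ∀ i : Fin k,
      l2 (u i) (transferApply β (u i)) * levelValue su2Rep 1 (oneSiteCoupling β L) 0 ≤
          Real.exp (C * luscherLambda β L ^ 2 / L) *
            (levelValue su2Rep 1 (oneSiteCoupling β L) ((i : ℕ) + 1) * levelValue su2Rep L β 0) * l2 (u i) (u i) ∧
      levelValue su2Rep 1 (oneSiteCoupling β L) ((i : ℕ) + 1) * levelValue su2Rep L β 0 * l2 (u i) (u i) ≤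
          Real.exp (C * luscherLambda β L ^ 2 / L) *
            (l2 (u i) (transferApply β (u i)) * levelValue su2Rep 1 (oneSiteCoupling β L) 0))
    (h6 : ∀ i l : Fin k, i ≠ l →
      |l2 (u i) (transferApply β (u l)) -
          (l2 (u i) (transferApply β (u i)) / l2 (u i) (u i) + l2 (u l) (transferApply β (u l)) / l2 (u l) (u l)) / 2 *
            l2 (u i) (u l)|
        ≤ C * (luscherLambda β L ^ 2 / L) * levelValue su2Rep L β 0 *
            (Real.sqrt (l2 (u i) (u i)) * Real.sqrt (l2 (u l) (u l)))) :
    ∃ σ : Equiv.Perm (Fin k),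
      (∀ i : Fin k, 0 < l2 (u (σ i)) (u (σ i))) ∧
      (∀ i l : Fin k, i ≤ l →
        l2 (u (σ l)) (transferApply β (u (σ l))) * l2 (u (σ i)) (u (σ i)) ≤
          l2 (u (σ i)) (transferApply β (u (σ i))) * l2 (u (σ l)) (u (σ l))) ∧
      (∀ i l : Fin k, i ≠ l →
        |l2 (u (σ i)) (u (σ l))| ≤ C * luscherLambda β L * (Real.sqrt (l2 (u (σ i)) (u (σ i))) * Real.sqrt (l2 (u (σ l)) (u (σ l))))) ∧
      (∀ i : Fin k,
        l2 (transferApply β (u (σ i))) (transferApply β (u (σ i))) * l2 (u (σ i)) (u (σ i)) - l2 (u (σ i)) (transferApply β (u (σ i))) ^ 2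
          ≤ C * (luscherLambda β L ^ 3 / (L : ℝ) ^ 2) * levelValue su2Rep L β 0 ^ 2 * l2 (u (σ i)) (u (σ i)) ^ 2) ∧
      (∀ i : Fin k,
        l2 (u (σ i)) (transferApply β (u (σ i))) * levelValue su2Rep 1 (oneSiteCoupling β L) 0 ≤
            Real.exp (C * luscherLambda β L ^ 2 / L) *
              (levelValue su2Rep 1 (oneSiteCoupling β L) ((i : ℕ) + 1) * levelValue su2Rep L β 0) * l2 (u (σ i)) (u (σ i)) ∧
        levelValue su2Rep 1 (oneSiteCoupling β L) ((i : ℕ) + 1) * levelValue su2Rep L β 0 * l2 (u (σ i)) (u (σ i)) ≤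
            Real.exp (C * luscherLambda β L ^ 2 / L) *
              (l2 (u (σ i)) (transferApply β (u (σ i))) * levelValue su2Rep 1 (oneSiteCoupling β L) 0)) ∧
      (∀ i l : Fin k, i ≠ l →
        |l2 (u (σ i)) (transferApply β (u (σ l))) -
            (l2 (u (σ i)) (transferApply β (u (σ i))) / l2 (u (σ i)) (u (σ i)) +
              l2 (u (σ l)) (transferApply β (u (σ l))) / l2 (u (σ l)) (u (σ l))) / 2 * l2 (u (σ i)) (u (σ l))|
          ≤ C * (luscherLambda β L ^ 2 / L) * levelValue su2Rep L β 0 *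
              (Real.sqrt (l2 (u (σ i)) (u (σ i))) * Real.sqrt (l2 (u (σ l)) (u (σ l))))) := by
  set n : Fin k → ℝ := fun i => l2 (u i) (u i) with hn
  set d : Fin k → ℝ := fun i => l2 (u i) (transferApply β (u i)) with hd
  set r : Fin k → ℝ := fun i => d i / n i with hr
  obtain ⟨σ, hσ⟩ := exists_perm_antitone r
  have hB : 0 ≤ oneSiteCoupling β L := oneSiteCoupling_nonneg β L
  set μ0 : ℝ := levelValue su2Rep 1 (oneSiteCoupling β L) 0 with hμ0
  set l0 : ℝ := levelValue su2Rep L β 0 with hl0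
  set E : ℝ := Real.exp (C * luscherLambda β L ^ 2 / L) with hE
  have hE0 : 0 ≤ E := (Real.exp_pos _).le
  have hμ00 : 0 ≤ μ0 := levelValue_su2Rep_nonneg 1 hB 0
  have hl00 : 0 ≤ l0 := levelValue_su2Rep_nonneg L hβ 0
  set μ : Fin k → ℝ := fun j => levelValue su2Rep 1 (oneSiteCoupling β L) ((j : ℕ) + 1) with hμdef
  have hμanti : Antitone μ := fun i l hil =>
    levelValue_antitone (L := 1) hB (Nat.succ_le_succ (Fin.le_def.mp hil))
  -- (o5) in ratio form
  have h5r : ∀ i, r i * μ0 ≤ E * (μ i * l0) ∧ μ i * l0 ≤ E * (r i * μ0) := by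
    intro i
    obtain ⟨ha, hb⟩ := h5 i
    have hni : 0 < n i := h0 i
    constructor
    · rw [hr]
      show d i / n i * μ0 ≤ E * (μ i * l0)
      rw [div_mul_eq_mul_div, div_le_iff₀ hni]
      exact ha
    · rw [hr]
      show μ i * l0 ≤ E * (d i / n i * μ0)
      rw [div_mul_eq_mul_div, mul_div_assoc', le_div_iff₀ hni]
      exact hb
  have h51 : ∀ j, (fun i => r i * μ0) (σ j) ≤ (fun j => E * (μ j * l0)) j := by
    refine sorted_le_of_le σ (a := fun i => r i * μ0) (b := fun j => E * (μ j * l0)) ?_ ?_ (fun i => (h5r i).1)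
    · exact fun i l hil => mul_le_mul_of_nonneg_right (hσ hil) hμ00
    · exact fun i l hil => mul_le_mul_of_nonneg_left (mul_le_mul_of_nonneg_right (hμanti hil) hl00) hE0
  have h52 : ∀ j, (fun j => μ j * l0) j ≤ (fun i => E * (r i * μ0)) (σ j) := by
    refine le_sorted_of_le σ (a := fun i => E * (r i * μ0)) (b := fun j => μ j * l0) ?_ ?_ (fun i => (h5r i).2)
    · exact fun i l hil => mul_le_mul_of_nonneg_left (mul_le_mul_of_nonneg_right (hσ hil) hμ00) hE0
    · exact fun i l hil => mul_le_mul_of_nonneg_right (hμanti hil) hl00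
  refine ⟨σ, fun i => h0 _, fun i l hil => ?_, fun i l hil => h2 _ _ (fun h => hil (σ.injective h)), fun i => h4 _,
    fun j => ⟨?_, ?_⟩, fun i l hil => h6 _ _ (fun h => hil (σ.injective h))⟩
  · -- (o1) from `r ∘ σ` antitone
    have hrr : r (σ l) ≤ r (σ i) := hσ hil
    have h1 := (div_le_div_iff₀ (h0 (σ l)) (h0 (σ i))).mp hrr
    show d (σ l) * n (σ i) ≤ d (σ i) * n (σ l)
    linarith
  · have h := h51 j
    have hnj : 0 < n (σ j) := h0 (σ j)
    simp only [hr] at h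
    have h' := mul_le_mul_of_nonneg_right h hnj.le
    rw [div_mul_eq_mul_div, div_mul_cancel₀ _ hnj.ne'] at h'
    show d (σ j) * μ0 ≤ E * (μ j * l0) * n (σ j)
    exact h'
  · have h := h52 j
    have hnj : 0 < n (σ j) := h0 (σ j)
    simp only [hr] at h
    have h' := mul_le_mul_of_nonneg_right h hnj.le
    rw [show E * (d (σ j) / n (σ j) * μ0) * n (σ j) = E * (d (σ j) * μ0) by
      rw [div_mul_eq_mul_div]; field_simp] at h'
    show μ j * l0 * n (σ j) ≤ E * (d (σ j) * μ0)
    exact h'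

/-- ★★ **`OperatorPlateauAt k` from (o0), (o2)–(o6) only** (no ordering, no spread): relabel the insertions (`operatorCore_of_unsorted`),
then file 7 (`operatorPlateauAt_of_core`).  The hypothesis is `OperatorPlateauAt k` with `PlateauClauses` replaced by its clauses
(o0), (o2), (o4), (o5), (o6) for `u_i := ins φ O_i`. [cite: LuscherWolff1990] -/
theorem operatorPlateauAt_of_unsorted {k : ℕ}
    (h : ∃ C lam0 : ℝ, 0 ≤ C ∧ 0 < lam0 ∧ ∀ lam : ℝ, 0 < lam → lam ≤ lam0 → ∃ L0 : ℕ,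
      ∀ (L : ℕ) [NeZero L], L0 ≤ L → ∀ β : ℝ, InFemtoWindow lam β L →
        ∃ φ : GaugeConfig 3 L SU2 → ℝ, IsPhys φ ∧ l2 φ φ = 1 ∧
          transferApply β φ = levelValue su2Rep L β 0 • φ ∧
        ∃ u : Fin k → (GaugeConfig 3 L SU2 → ℝ), (∃ O : Fin k → (GaugeConfig 3 L SU2 → ℝ),
            (∀ i, IsPhys (O i)) ∧ u = fun i => OpPlat.ins φ (O i)) ∧
          (∀ i : Fin k, 0 < l2 (u i) (u i)) ∧
          (∀ i l : Fin k, i ≠ l →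
            |l2 (u i) (u l)| ≤ C * luscherLambda β L * (Real.sqrt (l2 (u i) (u i)) * Real.sqrt (l2 (u l) (u l)))) ∧
          (∀ i : Fin k,
            l2 (transferApply β (u i)) (transferApply β (u i)) * l2 (u i) (u i) - l2 (u i) (transferApply β (u i)) ^ 2
              ≤ C * (luscherLambda β L ^ 3 / (L : ℝ) ^ 2) * levelValue su2Rep L β 0 ^ 2 * l2 (u i) (u i) ^ 2) ∧
          (∀ i : Fin k,
            l2 (u i) (transferApply β (u i)) * levelValue su2Rep 1 (oneSiteCoupling β L) 0 ≤
                Real.exp (C * luscherLambda β L ^ 2 / L) *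
                  (levelValue su2Rep 1 (oneSiteCoupling β L) ((i : ℕ) + 1) * levelValue su2Rep L β 0) * l2 (u i) (u i) ∧
            levelValue su2Rep 1 (oneSiteCoupling β L) ((i : ℕ) + 1) * levelValue su2Rep L β 0 * l2 (u i) (u i) ≤
                Real.exp (C * luscherLambda β L ^ 2 / L) *
                  (l2 (u i) (transferApply β (u i)) * levelValue su2Rep 1 (oneSiteCoupling β L) 0)) ∧
          (∀ i l : Fin k, i ≠ l →
            |l2 (u i) (transferApply β (u l)) -
                (l2 (u i) (transferApply β (u i)) / l2 (u i) (u i) + l2 (u l) (transferApply β (u l)) / l2 (u l) (u l)) / 2 *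
                  l2 (u i) (u l)|
              ≤ C * (luscherLambda β L ^ 2 / L) * levelValue su2Rep L β 0 *
                  (Real.sqrt (l2 (u i) (u i)) * Real.sqrt (l2 (u l) (u l))))) :
    OpPlat.OperatorPlateauAt k := by
  obtain ⟨C, lam0, hC0, hlam0, hC⟩ := h
  refine operatorPlateauAt_of_core ⟨C, lam0, hC0, hlam0, fun lam hlam hle => ?_⟩
  obtain ⟨L0, hL⟩ := hC lam hlam hle
  refine ⟨L0, fun L _ hL0 β hW => ?_⟩
  obtain ⟨φ, hφ, hφ1, hKφ, u, ⟨O, hO, rfl⟩, h0, h2, h4, h5, h6⟩ := hL L hL0 β hW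
  have hβ : (0 : ℝ) ≤ β := zero_le_one.trans hW.1
  obtain ⟨σ, g0, g1, g2, g4, g5, g6⟩ := operatorCore_of_unsorted hβ h0 h2 h4 h5 h6
  exact ⟨φ, hφ, hφ1, hKφ, fun i => OpPlat.ins φ (O (σ i)), ⟨fun i => O (σ i), fun i => hO _, rfl⟩, g0, g1, g2, g4, g5, g6⟩

end Summit.QuantumFields.YangMills.Theorems.FemtoTransferGap.KTGen

end
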